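import Mathlib
import Summits.CriticalPhenomena.PercolationContinuityZ3.Theorems.PercNearOneGluingNoHeavyLowerTailOrientedAntipodalHallTransitive

/-!
# The oriented antipodal Hall count from an ADMISSIBLE THREE-GROUP ASSIGNMENT (master form of Theorem O)

Helper file for crux `stmt-CriticalPhenomena-4575` (`NoHeavyLowerTail`, route `PercNearOneGluingNoHeavy`),
new-inequality factory seat `prim-ineq-gen-3` (gen 10).  Everything here is PROVED.

All capacity-one Hall counts of this line (single types and stars, chains, cyclic and transitive selections) are instances
of ONE statement.  Let `f : Finset α → Lab k` be monotone and let the antipodal bads be sorted into three groups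
`D₁, D₂, D₃`; each bad `X` carries a complementation bit `cpl X` (its MEMBER is `M X = S \ X` if `cpl X`, else `X`) and the
oriented labels `a X = f (M X)`, `b X = f (S \ M X)` (petals).  The assignment is ADMISSIBLE if
* within a group: equal bits, and `a X ≠ b X'`, `b X ≠ a X'` (so every within-group difference `M X \ M X'` is a co-good
  above a bad);
* across groups: `a X ≠ a X'`, `b X ≠ b X'`, at least one of the two complemented, and not (`a X = b X'` and
  `a X' = b X`) (so every cross meet is a NONEMPTY co-good above a bad);
* for `X ∈ D₁, Y ∈ D₂, Z ∈ D₃`: not `a X = b Y = b Z`, not `b X = a Y = a Z`, and (`cpl X` or `¬cpl Y` or `¬cpl Z`); and the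
  same with the roles of `D₁` and `D₃` exchanged (so the two OUTER double differences are co-goods above a bad).
**Theorem (`card_le_card_goods_above_of_assignment`).**  Under an admissible assignment,
`#D₁ + #D₂ + #D₃ ≤ #{U good : U ⊇ some bad}`; SDR form `exists_injective_good_above_of_assignment`.
Proof: the member families `P, Q, R` and the down-closed family of co-goods above a bad satisfy the hypotheses of
`ThreeFamilyRank.card_add_card_add_card_le_of_blocks` (Theorem A′ + TRIPLE⁻, gen 10).  The statement is independent of
the number `k` of petals: e.g. on four petals 29 of the 41 opposite-free type classes admit an admissible assignment
(memo `run/shared/lean/prim/prim-ineq-gen-3/PROOF-TRIPLEMINUS.md`, code-gen10/group_search.py); the four tournaments do not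
(conjecture O₄ open).  (prim-ineq-gen-3 gen 10, 2026-08-20.)
-/

namespace Summit.CriticalPhenomena.PercolationContinuityZ3.Theorems

namespace OrientedAntipodalHall

open Finset AntipodalStrongHarris AntipodalStrongHarris.Lab ThreeFamilyRank
open scoped FinsetFamily

variable {α : Type*} [DecidableEq α] {k : ℕ}

/-- A label below three petal-labelled sets, not all with the same petal, is `B`. -/
theorem eq_bot_of_le_three {x y z : Fin k} (h : ¬ (x = y ∧ y = z)) {c : Lab k}
    (hx : c ≤ petal x) (hy : c ≤ petal y) (hz : c ≤ petal z) : c = bot := by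
  rcases not_and_or.mp h with hxy | hyz
  · exact eq_bot_of_le_petal hxy hx hy
  · exact eq_bot_of_le_petal hyz hy hz

/-- A label above three petal-labelled sets, not all with the same petal, is `A`. -/
theorem eq_top_of_three_le {x y z : Fin k} (h : ¬ (x = y ∧ y = z)) {c : Lab k}
    (hx : petal x ≤ c) (hy : petal y ≤ c) (hz : petal z ≤ c) : c = top := by
  rcases not_and_or.mp h with hxy | hyz
  · exact eq_top_of_petal_le hxy hx hy
  · exact eq_top_of_petal_le hyz hy hz

/-- **The oriented antipodal Hall count from an admissible three-group assignment.**  See the module docstring: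
`D₁, D₂, D₃` are the three groups of bads (subsets of `S`), `cpl` the complementation bits, `a, b` the oriented petal
labels of the members `M X` (`= S \ X` if `cpl X`, else `X`) and of their complements; the hypotheses `hW₁ hW₂ hW₃`
(within groups), `hC₁₂ hC₂₃ hC₃₁` (across groups) and `hDD₁ hDD₃` (outer double differences) are the admissibility
conditions.  Conclusion: at least `#D₁ + #D₂ + #D₃` good sets contain a bad. -/
theorem card_le_card_goods_above_of_assignment (S : Finset α) {f : Finset α → Lab k}
    (hf : ∀ ⦃X Y : Finset α⦄, X ⊆ Y → f X ≤ f Y) (D₁ D₂ D₃ : Finset (Finset α))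
    (cpl : Finset α → Bool) (a b : Finset α → Fin k)
    (hlab : ∀ X ∈ D₁ ∪ D₂ ∪ D₃, X ⊆ S ∧ (cpl X = false → f X = petal (a X) ∧ f (S \ X) = petal (b X)) ∧
      (cpl X = true → f (S \ X) = petal (a X) ∧ f X = petal (b X)))
    (hW₁ : ∀ X ∈ D₁, ∀ X' ∈ D₁, cpl X = cpl X' ∧ a X ≠ b X' ∧ b X ≠ a X')
    (hW₂ : ∀ X ∈ D₂, ∀ X' ∈ D₂, cpl X = cpl X' ∧ a X ≠ b X' ∧ b X ≠ a X')
    (hW₃ : ∀ X ∈ D₃, ∀ X' ∈ D₃, cpl X = cpl X' ∧ a X ≠ b X' ∧ b X ≠ a X')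
    (hC₁₂ : ∀ X ∈ D₁, ∀ Y ∈ D₂, a X ≠ a Y ∧ b X ≠ b Y ∧ (cpl X = true ∨ cpl Y = true) ∧ ¬ (a X = b Y ∧ a Y = b X))
    (hC₂₃ : ∀ Y ∈ D₂, ∀ Z ∈ D₃, a Y ≠ a Z ∧ b Y ≠ b Z ∧ (cpl Y = true ∨ cpl Z = true) ∧ ¬ (a Y = b Z ∧ a Z = b Y))
    (hC₃₁ : ∀ Z ∈ D₃, ∀ X ∈ D₁, a Z ≠ a X ∧ b Z ≠ b X ∧ (cpl Z = true ∨ cpl X = true) ∧ ¬ (a Z = b X ∧ a X = b Z))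
    (hDD₁ : ∀ X ∈ D₁, ∀ Y ∈ D₂, ∀ Z ∈ D₃,
      ¬ (a X = b Y ∧ b Y = b Z) ∧ ¬ (b X = a Y ∧ a Y = a Z) ∧ (cpl X = true ∨ cpl Y = false ∨ cpl Z = false))
    (hDD₃ : ∀ X ∈ D₁, ∀ Y ∈ D₂, ∀ Z ∈ D₃,
      ¬ (a Z = b X ∧ b X = b Y) ∧ ¬ (b Z = a X ∧ a X = a Y) ∧ (cpl Z = true ∨ cpl X = false ∨ cpl Y = false)) :
    #D₁ + #D₂ + #D₃ ≤
      #{U ∈ S.powerset | f U = top ∧ f (S \ U) = bot ∧ ∃ X ∈ D₁ ∪ D₂ ∪ D₃, X ⊆ U} := by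
  -- the member of a bad
  set M : Finset α → Finset α := fun X => if cpl X = true then S \ X else X with hMdef
  have mem₁ : ∀ X ∈ D₁, X ∈ D₁ ∪ D₂ ∪ D₃ := fun X hX => mem_union_left _ (mem_union_left _ hX)
  have mem₂ : ∀ Y ∈ D₂, Y ∈ D₁ ∪ D₂ ∪ D₃ := fun Y hY => mem_union_left _ (mem_union_right _ hY)
  have mem₃ : ∀ Z ∈ D₃, Z ∈ D₁ ∪ D₂ ∪ D₃ := fun Z hZ => mem_union_right _ hZ
  have hXS : ∀ X ∈ D₁ ∪ D₂ ∪ D₃, X ⊆ S := fun X hX => (hlab X hX).1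
  have hMS : ∀ X ∈ D₁ ∪ D₂ ∪ D₃, M X ⊆ S := by
    intro X hX
    simp only [hMdef]
    split_ifs
    · exact sdiff_subset
    · exact hXS X hX
  have hMa : ∀ X ∈ D₁ ∪ D₂ ∪ D₃, f (M X) = petal (a X) := by
    intro X hX
    simp only [hMdef]
    by_cases hc : cpl X = true
    · rw [if_pos hc]; exact ((hlab X hX).2.2 hc).1
    · rw [if_neg hc]; exact ((hlab X hX).2.1 (by simpa using hc)).1
  have hMb : ∀ X ∈ D₁ ∪ D₂ ∪ D₃, f (S \ M X) = petal (b X) := by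
    intro X hX
    simp only [hMdef]
    by_cases hc : cpl X = true
    · rw [if_pos hc, Finset.sdiff_sdiff_eq_self (hXS X hX)]; exact ((hlab X hX).2.2 hc).2
    · rw [if_neg hc]; exact ((hlab X hX).2.1 (by simpa using hc)).2
  -- the bad witnessed by a member: below `S \ F` when `F ⊆ M X` (complemented) or `F ⊆ S \ M X` (plain)
  have below : ∀ {X F : Finset α}, X ⊆ S → F ⊆ S \ X → X ⊆ S \ F :=
    fun hXS hF => subset_sdiff_of_subset_sdiff' hXS hF
  have badM : ∀ X ∈ D₁ ∪ D₂ ∪ D₃, cpl X = true → ∀ {F : Finset α}, F ⊆ M X → X ⊆ S \ F := by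
    intro X hX hc F hF
    simp only [hMdef, if_pos hc] at hF
    exact below (hXS X hX) hF
  have badM' : ∀ X ∈ D₁ ∪ D₂ ∪ D₃, cpl X = false → ∀ {F : Finset α}, F ⊆ S \ M X → X ⊆ S \ F := by
    intro X hX hc F hF
    have hc' : ¬ cpl X = true := by simp [hc]
    simp only [hMdef, if_neg hc'] at hF
    exact below (hXS X hX) hF
  -- the co-goods above a bad
  set 𝒢 : Finset (Finset α) :=
    {F ∈ S.powerset | f (S \ F) = top ∧ f F = bot ∧ ∃ X ∈ D₁ ∪ D₂ ∪ D₃, X ⊆ S \ F} with h𝒢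
  have h𝒢S : ∀ E ∈ 𝒢, E ⊆ S := fun E hE => by
    rw [h𝒢, mem_filter, mem_powerset] at hE; exact hE.1
  have h𝒢down : ∀ E ∈ 𝒢, ∀ F, F ⊆ E → F ∈ 𝒢 := by
    intro E hE F hFE
    rw [h𝒢, mem_filter, mem_powerset] at hE ⊢
    obtain ⟨hES, htop, hbot, X, hX, hXE⟩ := hE
    refine ⟨hFE.trans hES, eq_top_of_top_le ?_, eq_bot_of_le_bot ?_, X, hX,
      hXE.trans (sdiff_subset_sdiff le_rfl hFE)⟩
    · rw [← htop]; exact hf (sdiff_subset_sdiff le_rfl hFE)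
    · rw [← hbot]; exact hf hFE
  -- certification with two witnesses on each side
  have cert : ∀ {F U₁ U₂ V₁ V₂ : Finset α} {p q r s : Fin k}, F ⊆ S → p ≠ q → r ≠ s →
      f U₁ = petal p → f U₂ = petal q → U₁ ⊆ S \ F → U₂ ⊆ S \ F →
      f V₁ = petal r → f V₂ = petal s → F ⊆ V₁ → F ⊆ V₂ →
      (∃ X ∈ D₁ ∪ D₂ ∪ D₃, X ⊆ S \ F) → F ∈ 𝒢 := by
    intro F U₁ U₂ V₁ V₂ p q r s hFS hpq hrs hU₁ hU₂ h₁ h₂ hV₁ hV₂ h₃ h₄ hX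
    obtain ⟨htop, hbot⟩ := good_sdiff_of_witnesses S hf hFS hpq hrs hU₁ hU₂ h₁ h₂ hV₁ hV₂ h₃ h₄
    rw [Finset.sdiff_sdiff_eq_self hFS] at hbot
    rw [h𝒢, mem_filter, mem_powerset]
    exact ⟨hFS, htop, hbot, hX⟩
  -- certification with three witnesses on each side
  have cert₃ : ∀ {F U₁ U₂ U₃ V₁ V₂ V₃ : Finset α} {p q r x y z : Fin k}, F ⊆ S → ¬ (p = q ∧ q = r) →
      ¬ (x = y ∧ y = z) → f U₁ = petal p → f U₂ = petal q → f U₃ = petal r →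
      U₁ ⊆ S \ F → U₂ ⊆ S \ F → U₃ ⊆ S \ F →
      f V₁ = petal x → f V₂ = petal y → f V₃ = petal z → F ⊆ V₁ → F ⊆ V₂ → F ⊆ V₃ →
      (∃ X ∈ D₁ ∪ D₂ ∪ D₃, X ⊆ S \ F) → F ∈ 𝒢 := by
    intro F U₁ U₂ U₃ V₁ V₂ V₃ p q r x y z hFS hpqr hxyz hU₁ hU₂ hU₃ h₁ h₂ h₃ hV₁ hV₂ hV₃ h₄ h₅ h₆ hX
    rw [h𝒢, mem_filter, mem_powerset]
    refine ⟨hFS, ?_, ?_, hX⟩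
    · exact eq_top_of_three_le hpqr (by rw [← hU₁]; exact hf h₁) (by rw [← hU₂]; exact hf h₂)
        (by rw [← hU₃]; exact hf h₃)
    · exact eq_bot_of_le_three hxyz (by rw [← hV₁]; exact hf h₄) (by rw [← hV₂]; exact hf h₅)
        (by rw [← hV₃]; exact hf h₆)
  -- within-group differences
  have hWblock : ∀ D : Finset (Finset α), (∀ X ∈ D, X ∈ D₁ ∪ D₂ ∪ D₃) →
      (∀ X ∈ D, ∀ X' ∈ D, cpl X = cpl X' ∧ a X ≠ b X' ∧ b X ≠ a X') →
      ∀ U ∈ D.image M, ∀ U' ∈ D.image M, U \ U' ∈ 𝒢 := by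
    intro D hD hW U hU U' hU'
    obtain ⟨X, hX, rfl⟩ := mem_image.mp hU
    obtain ⟨X', hX', rfl⟩ := mem_image.mp hU'
    obtain ⟨hcc, hab, hba⟩ := hW X hX X' hX'
    have hFS : M X \ M X' ⊆ S := sdiff_subset.trans (hMS X (hD X hX))
    have hF1 : M X \ M X' ⊆ M X := sdiff_subset
    have hF2 : M X \ M X' ⊆ S \ M X' := sdiff_subset_sdiff (hMS X (hD X hX)) le_rfl
    -- a bad below the complement: `X` if complemented, `X'` if plain
    have hbad : ∃ X₀ ∈ D₁ ∪ D₂ ∪ D₃, X₀ ⊆ S \ (M X \ M X') := by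
      by_cases hc : cpl X = true
      · exact ⟨X, hD X hX, badM X (hD X hX) hc hF1⟩
      · have hc' : cpl X' = false := by rw [← hcc]; simpa using hc
        exact ⟨X', hD X' hX', badM' X' (hD X' hX') hc' hF2⟩
    exact cert hFS hba hab (hMb X (hD X hX)) (hMa X' (hD X' hX')) (sdiff_subset_sdiff le_rfl hF1)
      (below (hMS X' (hD X' hX')) hF2) (hMa X (hD X hX)) (hMb X' (hD X' hX')) hF1 hF2 hbad
  -- cross meets
  have hCblock : ∀ Dₛ Dₜ : Finset (Finset α), (∀ X ∈ Dₛ, X ∈ D₁ ∪ D₂ ∪ D₃) → (∀ Y ∈ Dₜ, Y ∈ D₁ ∪ D₂ ∪ D₃) →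
      (∀ X ∈ Dₛ, ∀ Y ∈ Dₜ, a X ≠ a Y ∧ b X ≠ b Y ∧ (cpl X = true ∨ cpl Y = true) ∧ ¬ (a X = b Y ∧ a Y = b X)) →
      ∀ U ∈ Dₛ.image M, ∀ U' ∈ Dₜ.image M, U ∩ U' ∈ 𝒢 ∧ (U ∩ U').Nonempty := by
    intro Dₛ Dₜ hDₛ hDₜ hC U hU U' hU'
    obtain ⟨X, hX, rfl⟩ := mem_image.mp hU
    obtain ⟨Y, hY, rfl⟩ := mem_image.mp hU'
    obtain ⟨haa, hbb, hcpl, hnopp⟩ := hC X hX Y hY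
    have hX3 := hDₛ X hX
    have hY3 := hDₜ Y hY
    have hF1 : M X ∩ M Y ⊆ M X := inter_subset_left
    have hF2 : M X ∩ M Y ⊆ M Y := inter_subset_right
    have hFS : M X ∩ M Y ⊆ S := hF1.trans (hMS X hX3)
    have hbad : ∃ X₀ ∈ D₁ ∪ D₂ ∪ D₃, X₀ ⊆ S \ (M X ∩ M Y) := by
      rcases hcpl with hc | hc
      · exact ⟨X, hX3, badM X hX3 hc hF1⟩
      · exact ⟨Y, hY3, badM Y hY3 hc hF2⟩
    refine ⟨cert hFS hbb haa (hMb X hX3) (hMb Y hY3) (sdiff_subset_sdiff le_rfl hF1)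
      (sdiff_subset_sdiff le_rfl hF2) (hMa X hX3) (hMa Y hY3) hF1 hF2 hbad, ?_⟩
    rw [nonempty_iff_ne_empty]
    intro he
    apply hnopp
    constructor
    · have hsub : M X ⊆ S \ M Y := by
        intro x hx
        refine mem_sdiff.mpr ⟨hMS X hX3 hx, fun hxY => ?_⟩
        have : x ∈ M X ∩ M Y := mem_inter.mpr ⟨hx, hxY⟩
        rw [he] at this
        simp at this
      exact eq_of_petal_le_petal (by rw [← hMa X hX3, ← hMb Y hY3]; exact hf hsub)
    · have hsub : M Y ⊆ S \ M X := by
        intro y hy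
        refine mem_sdiff.mpr ⟨hMS Y hY3 hy, fun hyX => ?_⟩
        have : y ∈ M X ∩ M Y := mem_inter.mpr ⟨hyX, hy⟩
        rw [he] at this
        simp at this
      exact eq_of_petal_le_petal (by rw [← hMa Y hY3, ← hMb X hX3]; exact hf hsub)
  -- unpacking a double difference inside `S`
  have dd_sub : ∀ {A B C : Finset α}, A ⊆ S →
      A \ (B ∪ C) ⊆ A ∧ A \ (B ∪ C) ⊆ S \ B ∧ A \ (B ∪ C) ⊆ S \ C := by
    intro A B C hAS
    refine ⟨sdiff_subset, fun x hx => ?_, fun x hx => ?_⟩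
    · have hx' := mem_sdiff.mp hx
      exact mem_sdiff.mpr ⟨hAS hx'.1, fun hxB => hx'.2 (mem_union_left _ hxB)⟩
    · have hx' := mem_sdiff.mp hx
      exact mem_sdiff.mpr ⟨hAS hx'.1, fun hxC => hx'.2 (mem_union_right _ hxC)⟩
  -- the two outer double differences
  have hDDPblock : ∀ U ∈ D₁.image M, ∀ U' ∈ D₂.image M, ∀ U'' ∈ D₃.image M, U \ (U' ∪ U'') ∈ 𝒢 := by
    intro U hU U' hU' U'' hU''
    obtain ⟨X, hX, rfl⟩ := mem_image.mp hU
    obtain ⟨Y, hY, rfl⟩ := mem_image.mp hU'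
    obtain ⟨Z, hZ, rfl⟩ := mem_image.mp hU''
    obtain ⟨h1, h2, h3⟩ := hDD₁ X hX Y hY Z hZ
    have hX3 := mem₁ X hX; have hY3 := mem₂ Y hY; have hZ3 := mem₃ Z hZ
    obtain ⟨hFX, hFY, hFZ⟩ := dd_sub (B := M Y) (C := M Z) (hMS X hX3)
    have hFS : M X \ (M Y ∪ M Z) ⊆ S := hFX.trans (hMS X hX3)
    have hbad : ∃ X₀ ∈ D₁ ∪ D₂ ∪ D₃, X₀ ⊆ S \ (M X \ (M Y ∪ M Z)) := by
      rcases h3 with hc | hc | hc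
      · exact ⟨X, hX3, badM X hX3 hc hFX⟩
      · exact ⟨Y, hY3, badM' Y hY3 hc hFY⟩
      · exact ⟨Z, hZ3, badM' Z hZ3 hc hFZ⟩
    have h2' : ¬ (b X = a Y ∧ a Y = a Z) := h2
    exact cert₃ hFS h2' h1 (hMb X hX3) (hMa Y hY3) (hMa Z hZ3) (sdiff_subset_sdiff le_rfl hFX)
      (below (hMS Y hY3) hFY) (below (hMS Z hZ3) hFZ) (hMa X hX3) (hMb Y hY3) (hMb Z hZ3) hFX hFY hFZ hbad
  have hDDRblock : ∀ U ∈ D₁.image M, ∀ U' ∈ D₂.image M, ∀ U'' ∈ D₃.image M, U'' \ (U ∪ U') ∈ 𝒢 := by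
    intro U hU U' hU' U'' hU''
    obtain ⟨X, hX, rfl⟩ := mem_image.mp hU
    obtain ⟨Y, hY, rfl⟩ := mem_image.mp hU'
    obtain ⟨Z, hZ, rfl⟩ := mem_image.mp hU''
    obtain ⟨h1, h2, h3⟩ := hDD₃ X hX Y hY Z hZ
    have hX3 := mem₁ X hX; have hY3 := mem₂ Y hY; have hZ3 := mem₃ Z hZ
    obtain ⟨hFZ, hFX, hFY⟩ := dd_sub (B := M X) (C := M Y) (hMS Z hZ3)
    have hFS : M Z \ (M X ∪ M Y) ⊆ S := hFZ.trans (hMS Z hZ3)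
    have hbad : ∃ X₀ ∈ D₁ ∪ D₂ ∪ D₃, X₀ ⊆ S \ (M Z \ (M X ∪ M Y)) := by
      rcases h3 with hc | hc | hc
      · exact ⟨Z, hZ3, badM Z hZ3 hc hFZ⟩
      · exact ⟨X, hX3, badM' X hX3 hc hFX⟩
      · exact ⟨Y, hY3, badM' Y hY3 hc hFY⟩
    exact cert₃ hFS h2 h1 (hMb Z hZ3) (hMa X hX3) (hMa Y hY3) (sdiff_subset_sdiff le_rfl hFZ)
      (below (hMS X hX3) hFX) (below (hMS Y hY3) hFY) (hMa Z hZ3) (hMb X hX3) (hMb Y hY3) hFZ hFX hFY hbad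
  -- the three member families
  set P : Finset (Finset α) := D₁.image M with hPdef
  set Q : Finset (Finset α) := D₂.image M with hQdef
  set R : Finset (Finset α) := D₃.image M with hRdef
  have hinjM : ∀ D : Finset (Finset α), (∀ X ∈ D, X ∈ D₁ ∪ D₂ ∪ D₃) →
      (∀ X ∈ D, ∀ X' ∈ D, cpl X = cpl X' ∧ a X ≠ b X' ∧ b X ≠ a X') → #(D.image M) = #D := by
    intro D hD hW
    apply card_image_of_injOn
    intro X hX X' hX' hXX'
    have hcc := (hW X hX X' hX').1
    simp only [hMdef] at hXX'
    by_cases hc : cpl X = true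
    · have hc' : cpl X' = true := by rw [← hcc]; exact hc
      rw [if_pos hc, if_pos hc'] at hXX'
      rw [← Finset.sdiff_sdiff_eq_self (hXS X (hD X hX)), ← Finset.sdiff_sdiff_eq_self (hXS X' (hD X' hX')), hXX']
    · have hc' : ¬ cpl X' = true := by rw [← hcc]; exact hc
      rw [if_neg hc, if_neg hc'] at hXX'
      exact hXX'
  have hcP : #P = #D₁ := hinjM D₁ mem₁ hW₁
  have hcQ : #Q = #D₂ := hinjM D₂ mem₂ hW₂
  have hcR : #R = #D₃ := hinjM D₃ mem₃ hW₃
  have hfamS : ∀ D : Finset (Finset α), (∀ X ∈ D, X ∈ D₁ ∪ D₂ ∪ D₃) → ∀ U ∈ D.image M, U ⊆ S := by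
    intro D hD U hU
    obtain ⟨X, hX, rfl⟩ := mem_image.mp hU
    exact hMS X (hD X hX)
  have hdisj : ∀ U ∈ P, U ∉ R := by
    intro U hU hUR
    obtain ⟨X, hX, rfl⟩ := mem_image.mp hU
    obtain ⟨Z, hZ, hZX⟩ := mem_image.mp hUR
    have h1 := hMa X (mem₁ X hX)
    rw [← hZX, hMa Z (mem₃ Z hZ)] at h1
    exact (hC₃₁ Z hZ X hX).1 (Lab.petal.inj h1)
  have hcount := card_add_card_add_card_le_of_blocks S 𝒢 P Q R h𝒢S h𝒢down (hfamS D₁ mem₁) (hfamS D₂ mem₂)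
    (hfamS D₃ mem₃) (hWblock D₁ mem₁ hW₁) (hWblock D₂ mem₂ hW₂) (hWblock D₃ mem₃ hW₃)
    (hCblock D₁ D₂ mem₁ mem₂ hC₁₂) (hCblock D₂ D₃ mem₂ mem₃ hC₂₃) (hCblock D₃ D₁ mem₃ mem₁ hC₃₁)
    hDDPblock hDDRblock hdisj
  -- complementation is injective on `𝒢` and lands in the goods above a bad
  have hinj𝒢 : Set.InjOn (fun F => S \ F) (𝒢 : Set (Finset α)) := by
    intro F₁ hF₁ F₂ hF₂ h
    have e₁ := Finset.sdiff_sdiff_eq_self (h𝒢S F₁ hF₁)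
    have e₂ := Finset.sdiff_sdiff_eq_self (h𝒢S F₂ hF₂)
    simp only at h
    rw [← e₁, ← e₂, h]
  have himg : 𝒢.image (fun F => S \ F) ⊆
      {U ∈ S.powerset | f U = top ∧ f (S \ U) = bot ∧ ∃ X ∈ D₁ ∪ D₂ ∪ D₃, X ⊆ U} := by
    intro U hU
    obtain ⟨F, hF, rfl⟩ := mem_image.mp hU
    rw [h𝒢, mem_filter, mem_powerset] at hF
    obtain ⟨hFS, htop, hbot, X, hX, hXF⟩ := hF
    rw [mem_filter, mem_powerset]
    refine ⟨sdiff_subset, htop, ?_, X, hX, hXF⟩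
    rw [Finset.sdiff_sdiff_eq_self hFS]; exact hbot
  calc #D₁ + #D₂ + #D₃ = #P + #Q + #R := by rw [hcP, hcQ, hcR]
    _ ≤ #𝒢 := hcount
    _ = #(𝒢.image fun F => S \ F) := (card_image_of_injOn hinj𝒢).symm
    _ ≤ _ := card_le_card himg

/-- **SDR form.**  Under an admissible three-group assignment the bads admit DISTINCT good representatives above them. -/
theorem exists_injective_good_above_of_assignment (S : Finset α) {f : Finset α → Lab k}
    (hf : ∀ ⦃X Y : Finset α⦄, X ⊆ Y → f X ≤ f Y) (D₁ D₂ D₃ : Finset (Finset α))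
    (cpl : Finset α → Bool) (a b : Finset α → Fin k)
    (hlab : ∀ X ∈ D₁ ∪ D₂ ∪ D₃, X ⊆ S ∧ (cpl X = false → f X = petal (a X) ∧ f (S \ X) = petal (b X)) ∧
      (cpl X = true → f (S \ X) = petal (a X) ∧ f X = petal (b X)))
    (hW₁ : ∀ X ∈ D₁, ∀ X' ∈ D₁, cpl X = cpl X' ∧ a X ≠ b X' ∧ b X ≠ a X')
    (hW₂ : ∀ X ∈ D₂, ∀ X' ∈ D₂, cpl X = cpl X' ∧ a X ≠ b X' ∧ b X ≠ a X')
    (hW₃ : ∀ X ∈ D₃, ∀ X' ∈ D₃, cpl X = cpl X' ∧ a X ≠ b X' ∧ b X ≠ a X')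
    (hC₁₂ : ∀ X ∈ D₁, ∀ Y ∈ D₂, a X ≠ a Y ∧ b X ≠ b Y ∧ (cpl X = true ∨ cpl Y = true) ∧ ¬ (a X = b Y ∧ a Y = b X))
    (hC₂₃ : ∀ Y ∈ D₂, ∀ Z ∈ D₃, a Y ≠ a Z ∧ b Y ≠ b Z ∧ (cpl Y = true ∨ cpl Z = true) ∧ ¬ (a Y = b Z ∧ a Z = b Y))
    (hC₃₁ : ∀ Z ∈ D₃, ∀ X ∈ D₁, a Z ≠ a X ∧ b Z ≠ b X ∧ (cpl Z = true ∨ cpl X = true) ∧ ¬ (a Z = b X ∧ a X = b Z))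
    (hDD₁ : ∀ X ∈ D₁, ∀ Y ∈ D₂, ∀ Z ∈ D₃,
      ¬ (a X = b Y ∧ b Y = b Z) ∧ ¬ (b X = a Y ∧ a Y = a Z) ∧ (cpl X = true ∨ cpl Y = false ∨ cpl Z = false))
    (hDD₃ : ∀ X ∈ D₁, ∀ Y ∈ D₂, ∀ Z ∈ D₃,
      ¬ (a Z = b X ∧ b X = b Y) ∧ ¬ (b Z = a X ∧ a X = a Y) ∧ (cpl Z = true ∨ cpl X = false ∨ cpl Y = false)) :
    ∃ φ : ↥(D₁ ∪ D₂ ∪ D₃) → Finset α, Function.Injective φ ∧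
      ∀ X : ↥(D₁ ∪ D₂ ∪ D₃), (X : Finset α) ⊆ φ X ∧ φ X ⊆ S ∧ f (φ X) = top ∧ f (S \ φ X) = bot := by
  classical
  let t : ↥(D₁ ∪ D₂ ∪ D₃) → Finset (Finset α) := fun X =>
    {U ∈ S.powerset | f U = top ∧ f (S \ U) = bot ∧ (X : Finset α) ⊆ U}
  have hHall : ∀ s : Finset ↥(D₁ ∪ D₂ ∪ D₃), #s ≤ #(s.biUnion t) := by
    intro s
    set D' : Finset (Finset α) := s.map (Function.Embedding.subtype _) with hD'
    have hD'sub : ∀ X ∈ D', X ∈ D₁ ∪ D₂ ∪ D₃ := by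
      intro X hX
      obtain ⟨x, -, rfl⟩ := mem_map.mp hX
      exact x.2
    set E₁ : Finset (Finset α) := D'.filter (· ∈ D₁) with hE₁
    set E₂ : Finset (Finset α) := (D'.filter (· ∉ D₁)).filter (· ∈ D₂) with hE₂
    set E₃ : Finset (Finset α) := (D'.filter (· ∉ D₁)).filter (· ∉ D₂) with hE₃
    have hE₁sub : ∀ X ∈ E₁, X ∈ D₁ := fun X hX => (mem_filter.mp hX).2
    have hE₂sub : ∀ X ∈ E₂, X ∈ D₂ := fun X hX => (mem_filter.mp hX).2
    have hE₃sub : ∀ X ∈ E₃, X ∈ D₃ := by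
      intro X hX
      obtain ⟨hX', hX2⟩ := mem_filter.mp hX
      obtain ⟨hXD', hX1⟩ := mem_filter.mp hX'
      rcases mem_union.mp (hD'sub X hXD') with h | h
      · rcases mem_union.mp h with h | h
        · exact absurd h hX1
        · exact absurd h hX2
      · exact h
    have hEsub : ∀ X ∈ E₁ ∪ E₂ ∪ E₃, X ∈ D₁ ∪ D₂ ∪ D₃ := by
      intro X hX
      rcases mem_union.mp hX with h | h
      · rcases mem_union.mp h with h | h
        · exact mem_union_left _ (mem_union_left _ (hE₁sub X h))
        · exact mem_union_left _ (mem_union_right _ (hE₂sub X h))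
      · exact mem_union_right _ (hE₃sub X h)
    have hcard : #s = #E₁ + #E₂ + #E₃ := by
      rw [hE₁, hE₂, hE₃, add_assoc, card_filter_add_card_filter_not, card_filter_add_card_filter_not]
      exact (card_map _).symm
    have hle := card_le_card_goods_above_of_assignment S hf E₁ E₂ E₃ cpl a b
      (fun X hX => hlab X (hEsub X hX))
      (fun X hX X' hX' => hW₁ X (hE₁sub X hX) X' (hE₁sub X' hX'))
      (fun X hX X' hX' => hW₂ X (hE₂sub X hX) X' (hE₂sub X' hX'))
      (fun X hX X' hX' => hW₃ X (hE₃sub X hX) X' (hE₃sub X' hX'))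
      (fun X hX Y hY => hC₁₂ X (hE₁sub X hX) Y (hE₂sub Y hY))
      (fun Y hY Z hZ => hC₂₃ Y (hE₂sub Y hY) Z (hE₃sub Z hZ))
      (fun Z hZ X hX => hC₃₁ Z (hE₃sub Z hZ) X (hE₁sub X hX))
      (fun X hX Y hY Z hZ => hDD₁ X (hE₁sub X hX) Y (hE₂sub Y hY) Z (hE₃sub Z hZ))
      (fun X hX Y hY Z hZ => hDD₃ X (hE₁sub X hX) Y (hE₂sub Y hY) Z (hE₃sub Z hZ))
    have hED' : ∀ X ∈ E₁ ∪ E₂ ∪ E₃, X ∈ D' := by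
      intro X hX
      rcases mem_union.mp hX with h | h
      · rcases mem_union.mp h with h | h
        · exact (mem_filter.mp h).1
        · exact (mem_filter.mp (mem_filter.mp h).1).1
      · exact (mem_filter.mp (mem_filter.mp h).1).1
    have hgoods : {U ∈ S.powerset | f U = top ∧ f (S \ U) = bot ∧ ∃ X ∈ E₁ ∪ E₂ ∪ E₃, X ⊆ U} ⊆
        s.biUnion t := by
      intro U hU
      rw [mem_filter, mem_powerset] at hU
      obtain ⟨hUS, hUtop, hUbot, X, hX, hXU⟩ := hU
      obtain ⟨x, hx, rfl⟩ := mem_map.mp (hED' X hX)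
      rw [mem_biUnion]
      refine ⟨x, hx, ?_⟩
      simp only [t, mem_filter, mem_powerset]
      exact ⟨hUS, hUtop, hUbot, hXU⟩
    calc #s = #E₁ + #E₂ + #E₃ := hcard
      _ ≤ #{U ∈ S.powerset | f U = top ∧ f (S \ U) = bot ∧ ∃ X ∈ E₁ ∪ E₂ ∪ E₃, X ⊆ U} := hle
      _ ≤ #(s.biUnion t) := card_le_card hgoods
  obtain ⟨φ, hφinj, hφ⟩ := (all_card_le_biUnion_card_iff_exists_injective t).mp hHall
  refine ⟨φ, hφinj, fun X => ?_⟩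
  have hX := hφ X
  simp only [t, mem_filter, mem_powerset] at hX
  exact ⟨hX.2.2.2, hX.1, hX.2.1, hX.2.2.1⟩

end OrientedAntipodalHall

end Summit.CriticalPhenomena.PercolationContinuityZ3.Theorems
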